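import Summits.ResolutionOfSingularities.ResolutionOfSingularities.Theorems.PurelyInseparableDim4JointWaitingStepCover
import Summits.ResolutionOfSingularities.ResolutionOfSingularities.Theorems.PurelyInseparableDim4JointWaitingRootHost
import Summits.ResolutionOfSingularities.ResolutionOfSingularities.Theorems.PurelyInseparableDim4JointWaitingMember
import Summits.ResolutionOfSingularities.ResolutionOfSingularities.Theorems.PurelyInseparableDim4JointForestNormalised
import HarnessLib

/-!
# Purely inseparable four-folds: the MONOTONE JOINT FOREST FROM A ROOT HOST WITH WAITING MEMBERS (brick S3 (c) «joint
# point∘coordinate chains», part 38 = v3-lite root theorem; cell `res-dim4-pi`)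

[OURS · counted 0] (D-0157 DOOR 2; desk WORD #66 (4)(c), #74 (g), #99 (d); frame `PIDim4.TerminationImpliesOrderReduction`,
S3 (c) v3-lite, memo `S3c-V3-DESIGN.md` Addenda 2–4; host item stmt-ResolutionOfSingularities-16155, helper). Nothing here
proves resolution of singularities in dimension ≥ 4 / characteristic `p` — NOT here, not anywhere in this programme.

The v2 root theorem (part 21) needs the initial coordinate members of the order-`p` locus of `z^p + F` to be pairwise
DISJOINT. When they INTERSECT (memo Addendum 2: `F = x₁^p x₂^p x₃`; the toy `F = x₁^p x₄ + x₁x₂^{p−1}(x₃^p − 1)` of part 32a,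
order-`p` locus `V(z, x₁, x₂) ∪ V(z, x₁, x₃ − 1)`), Hironaka blows up ONE member first — the HOST `(b₀, S₀)` — while the
others WAIT; after that blow-up the strict transforms of the waiting members are disjoint transversal coordinate members of
the next stage (the waiting kids of part 35), and the v2 forest takes over. THIS FILE proves that assembly:

* **`exists_isMarkedResolution_joint_forest_root_waiting`** — `K = K̄` of characteristic `p`, `F ≠ 0` clean; a HOST
  `(b₀, S₀)` (permissible for the re-centred cleaned equation, state `s₀`) with its ROOT NODE: finitely many plan entries
  `Pl₀` (`S₀ ⊆ S″`, admissible, separated), finitely many WAITING ENTRIES `Wt` — `(j, c, T)` in host-relative coordinates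
  (`j ∈ S₀`, `c|_{S₀} = 0`, `S₀ ∖ {j} ⊆ T`, `j ∉ T`, `V(z, x_T)` permissible for `z^p + s₀.F(x + c)`, i.e. the waiting member
  `{x_i = b₀_i + c_i (i ∈ T)}` of the hypersurface), same-chart separated among themselves and from `Pl₀` — and finitely many
  leaves `L₀` with their point walks, under the THREE-WAY normalised cover «child or waiting kid or leaf» (part 37d); BELOW the
  children and the waiting kids the v2 hereditary plan conditions (`plan`, `leaves`) and `Acc`; and a ROOT COVER: every root
  parameter of order `p` agrees with the host on `S₀` or with a waiting member on its `T` ⇒ `(𝔸⁵_K, (z^p + F)·𝒪, [], p)`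
  admits a marked resolution (BGMW Def. 3.1.3).

Assembly: part 38a's host package, typ-2's comparison `ε` for the blow-up of the host, part 37d's step (children, waiting
kids, leaves, three-way cover), then part 20's node theorem `exists_isMarkedResolution_of_joint_forest_normalised` at the
first blown-up stage with members = children ∪ waiting kids and point members = the leaves off all of them. HONEST SCOPE: one
host, no other root members, no isolated root points, waiting members hosted at the root only (v3-lite); children `S ⊆ S″`
below (v2); `Acc` is a hypothesis. AI-produced formalisation, weaker than expert review.
bears_on: LADDER-RESOLUTION:D157-DOOR2 (res-dim4-pi · S3 (c) joint v3-lite · root).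
-/

set_option linter.dupNamespace false -- D-0017: single-problem summit path `Summit.<S>.<S>.…` by design

noncomputable section

open MvPolynomial Finset CategoryTheory AlgebraicGeometry Opposite TopologicalSpace
open AlgebraicGeometry.Scheme.IdealSheafData (ofIdealTop vanishingIdeal)

namespace Summit.ResolutionOfSingularities.ResolutionOfSingularities.Theorems.PIDim4

open Literature.AlgebraicGeometry.Resolution
open Literature.AlgebraicGeometry.Resolution.Hauser2010
open Literature.AlgebraicGeometry.Resolution.AffinePointBlowup (P A γ coord Wtop ξ)

namespace Equimultiple

section RootWaiting

variable {K : Type} [Field K] {p : ℕ} [hp : Fact p.Prime] [CharP K p]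

/-- **THE MONOTONE JOINT FOREST FROM A ROOT HOST WITH WAITING MEMBERS.** See the module docstring.
[cite: BierstoneGrigorievMilmanWlodarczyk2011, Def. 3.1.3; §4 Step 2b] [cite: Hauser2010, §§F–G]
[cite: HauserPerlega2019PRIMS, §2 (permissible centres P = (z, x_i : i ∈ Γ))]
[cite: Hironaka1964, Main Theorem I (the characteristic-zero statement whose analogue is asked)] -/
theorem exists_isMarkedResolution_joint_forest_root_waiting [IsAlgClosed K] [DecidableEq K] (F : MvPolynomial (Fin 4) K)
    (hF : F ≠ 0) (hclean : Literature.Barriers.ResolutionOfSingularities.HauserPerlega.IsClean p F)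
    (plan : State K → Finset (Fin 4) → Finset (Fin 4 × (Fin 4 → K) × Finset (Fin 4)))
    (leaves : State K → Finset (Fin 4) → Finset (Fin 4 × (Fin 4 → K)))
    (b₀ : Fin 4 → K) (S₀ : Finset (Fin 4)) (s₀ : State K)
    (hs₀ : s₀ = ⟨deletePthPowers p (PointBlowup.translate b₀ F), 0, ∅⟩) (hS₀ : IsPermissibleCentre p S₀ s₀.F)
    (Pl₀ : Finset (Fin 4 × (Fin 4 → K) × Finset (Fin 4))) (Wt : Finset (Fin 4 × (Fin 4 → K) × Finset (Fin 4)))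
    (L₀ : Finset (Fin 4 × (Fin 4 → K)))
    (hP1₀ : ∀ e ∈ Pl₀, e.1 ∈ S₀ ∧ e.2.1 e.1 = 0 ∧ S₀ ⊆ e.2.2 ∧ CentreBlowup.IsEquimultiplePoint p S₀ e.1 e.2.1 s₀ ∧
      IsPermissibleCentre p e.2.2 (CentreBlowup.step p S₀ e.1 e.2.1 s₀).F)
    (hP2₀ : ∀ e ∈ Pl₀, ∀ e' ∈ Pl₀, e ≠ e' →
      (e.1 = e'.1 ∧ ∃ i ∈ e.2.2, i ∈ e'.2.2 ∧ e.2.1 i ≠ e'.2.1 i) ∨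
      (e.1 ≠ e'.1 ∧ ((e'.2.1 e.1 = 0 ∧ e.1 ∈ e'.2.2) ∨ (e.2.1 e'.1 = 0 ∧ e'.1 ∈ e.2.2))))
    (hW1 : ∀ wt ∈ Wt, wt.1 ∈ S₀ ∧ (∀ i ∈ S₀, wt.2.1 i = 0) ∧ S₀.erase wt.1 ⊆ wt.2.2 ∧ wt.1 ∉ wt.2.2 ∧
      IsPermissibleCentre p wt.2.2 (PointBlowup.translate wt.2.1 s₀.F))
    (hW2 : ∀ wt ∈ Wt, ∀ wt' ∈ Wt, wt ≠ wt' → wt.1 = wt'.1 → ∃ i ∈ wt.2.2, i ∈ wt'.2.2 ∧ wt.2.1 i ≠ wt'.2.1 i)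
    (hPW : ∀ e ∈ Pl₀, ∀ wt ∈ Wt, e.1 = wt.1 → ∃ i ∈ e.2.2, i ∈ wt.2.2 ∧ e.2.1 i ≠ wt.2.1 i)
    (hP3₀ : ∀ l ∈ L₀, CentreBlowup.IsEquimultiplePoint p S₀ l.1 l.2 s₀ →
      Acc (fun s' s : State K => Edge p Finset.univ s s') (CentreBlowup.step p S₀ l.1 l.2 s₀) ∧
      ∀ s' : State K, Relation.ReflTransGen (fun a e : State K => Edge p Finset.univ a e)
          (CentreBlowup.step p S₀ l.1 l.2 s₀) s' →
        {jb : Fin 4 × (Fin 4 → K) | jb.2 jb.1 = 0 ∧ CentreBlowup.IsEquimultiplePoint p Finset.univ jb.1 jb.2 s'}.Finite)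
    (hcover₀ : ∀ (j' : Fin 4) (b' : Fin 4 → K), j' ∈ S₀ → b' j' = 0 → (∀ k ∈ S₀, k < j' → b' k = 0) →
      CentreBlowup.IsEquimultiplePoint p S₀ j' b' s₀ →
      (∃ e ∈ Pl₀, e.1 = j' ∧ ∀ i ∈ e.2.2, b' i = e.2.1 i) ∨ (∃ wt ∈ Wt, wt.1 = j' ∧ ∀ i ∈ wt.2.2, b' i = wt.2.1 i) ∨
        (j', b') ∈ L₀)
    (hplan : ∀ q : State K × Finset (Fin 4),
      ((∃ e ∈ Pl₀, Relation.ReflTransGen (fun q q' : State K × Finset (Fin 4) =>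
          ∃ e ∈ plan q.1 q.2, q' = (CentreBlowup.step p q.2 e.1 e.2.1 q.1, e.2.2))
          (CentreBlowup.step p S₀ e.1 e.2.1 s₀, e.2.2) q) ∨
        ∃ wt ∈ Wt, Relation.ReflTransGen (fun q q' : State K × Finset (Fin 4) =>
          ∃ e ∈ plan q.1 q.2, q' = (CentreBlowup.step p q.2 e.1 e.2.1 q.1, e.2.2))
          (CentreBlowup.step p S₀ wt.1 wt.2.1 s₀, wt.2.2) q) →
      (∀ e ∈ plan q.1 q.2, e.1 ∈ q.2 ∧ e.2.1 e.1 = 0 ∧ q.2 ⊆ e.2.2 ∧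
          CentreBlowup.IsEquimultiplePoint p q.2 e.1 e.2.1 q.1 ∧
          IsPermissibleCentre p e.2.2 (CentreBlowup.step p q.2 e.1 e.2.1 q.1).F) ∧
      (∀ e ∈ plan q.1 q.2, ∀ e' ∈ plan q.1 q.2, e ≠ e' →
          (e.1 = e'.1 ∧ ∃ i ∈ e.2.2, i ∈ e'.2.2 ∧ e.2.1 i ≠ e'.2.1 i) ∨
          (e.1 ≠ e'.1 ∧ ((e'.2.1 e.1 = 0 ∧ e.1 ∈ e'.2.2) ∨ (e.2.1 e'.1 = 0 ∧ e'.1 ∈ e.2.2)))) ∧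
      (∀ l ∈ leaves q.1 q.2, CentreBlowup.IsEquimultiplePoint p q.2 l.1 l.2 q.1 →
          Acc (fun s' s : State K => Edge p Finset.univ s s') (CentreBlowup.step p q.2 l.1 l.2 q.1) ∧
          ∀ s' : State K, Relation.ReflTransGen (fun a e : State K => Edge p Finset.univ a e)
              (CentreBlowup.step p q.2 l.1 l.2 q.1) s' →
            {jb : Fin 4 × (Fin 4 → K) | jb.2 jb.1 = 0 ∧
              CentreBlowup.IsEquimultiplePoint p Finset.univ jb.1 jb.2 s'}.Finite) ∧
      (∀ (j' : Fin 4) (b' : Fin 4 → K), j' ∈ q.2 → b' j' = 0 → (∀ k ∈ q.2, k < j' → b' k = 0) →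
          CentreBlowup.IsEquimultiplePoint p q.2 j' b' q.1 →
          (∃ e ∈ plan q.1 q.2, e.1 = j' ∧ ∀ i ∈ e.2.2, b' i = e.2.1 i) ∨ (j', b') ∈ leaves q.1 q.2))
    (hacc : ∀ e ∈ Pl₀, Acc (fun q' q : State K × Finset (Fin 4) =>
        ∃ e ∈ plan q.1 q.2, q' = (CentreBlowup.step p q.2 e.1 e.2.1 q.1, e.2.2))
      (CentreBlowup.step p S₀ e.1 e.2.1 s₀, e.2.2))
    (hWacc : ∀ wt ∈ Wt, Acc (fun q' q : State K × Finset (Fin 4) =>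
        ∃ e ∈ plan q.1 q.2, q' = (CentreBlowup.step p q.2 e.1 e.2.1 q.1, e.2.2))
      (CentreBlowup.step p S₀ wt.1 wt.2.1 s₀, wt.2.2))
    (hroots : ∀ b' : Fin 4 → K,
      (∀ d : Fin 4 →₀ ℕ, d ≠ 0 → d.degree < p → coeff d (PointBlowup.translate b' F) = 0) →
      (∀ i ∈ S₀, b' i = b₀ i) ∨ ∃ wt ∈ Wt, ∀ i ∈ wt.2.2, b' i = b₀ i + wt.2.1 i) :
    ∃ (X' : Scheme.{0}) (ρ : X' ⟶ P 4 K) (M' : MarkedIdeal X'),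
      IsMarkedResolution (⟨hypSheaf p F, [], p⟩ : MarkedIdeal (P 4 K)) ρ M' := by
  classical
  haveI : PerfectRing K p := PerfectRing.ofSurjective K p fun x => IsAlgClosed.exists_pow_nat_eq x hp.out.pos
  set M₀ : MarkedIdeal (P 4 K) := ⟨hypSheaf p F, [], p⟩ with hM₀
  have hE₀ : HasSNC M₀.boundary :=
    hasSNC_nil_of_isRegular (Literature.AlgebraicGeometry.Hironaka2017.Lib.AffinePointBlowupLSB.isRegular_Z 4 K)
  have hF₀ : s₀.F ≠ 0 := by rw [hs₀]; exact deletePthPowers_translate_ne_zero hF hclean b₀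
  have hclean₀ : Literature.Barriers.ResolutionOfSingularities.HauserPerlega.IsClean p s₀.F := by
    rw [hs₀]; exact isClean_deletePthPowers _
  have hS₀' : IsPermissibleCentre p S₀ (deletePthPowers p (PointBlowup.translate b₀ F)) := by rw [hs₀] at hS₀; exact hS₀
  set Pl := Pl₀ with hPl
  set L := L₀ with hL
  -- the host, through its re-centring chart
  obtain ⟨φ, _, c₀, hsurj, hMφ, hcoord', hcoe₀, hreg₀, hsnc₀, hZ₀, hin₀, hon₀⟩ := root_host_package (p := p) F b₀ hS₀'
  have hM : M₀.ideal.comap φ = (hypSheaf p s₀.F).comap (𝟙 (P 4 K)) := by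
    rw [Scheme.IdealSheafData.comap_id, hs₀]; exact hMφ
  set Λ : Set (Fin (4 + 1)) := insert 0 (Fin.succ '' (S₀ : Set (Fin 4))) with hΛ
  have hid : ∀ T : Set (P 4 K), (𝟙 (P 4 K) : P 4 K ⟶ P 4 K) ⁻¹' T = T := fun T => rfl
  have himg : φ '' ((𝟙 (P 4 K) : P 4 K ⟶ P 4 K) ⁻¹' (AffineCoordBlowup.CΛ 4 K Λ : Set (P 4 K))) = (c₀ : Set (P 4 K)) := by
    rw [hid, hcoe₀]
  have hT₀ : IsClosed (φ '' ((𝟙 (P 4 K) : P 4 K ⟶ P 4 K) ⁻¹' (AffineCoordBlowup.CΛ 4 K Λ : Set (P 4 K)))) :=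
    himg ▸ c₀.isClosed
  have hsee₀ : (AffineCoordBlowup.CΛ 4 K Λ : Set (P 4 K)) ⊆ Set.range (𝟙 (P 4 K) : P 4 K ⟶ P 4 K) := fun y _ => ⟨y, rfl⟩
  have hψ : ∀ x : P 4 K, x ∈ Set.range (𝟙 (P 4 K) : P 4 K ⟶ P 4 K) := fun x => ⟨x, rfl⟩
  have hφc : IsClosed (Set.range φ) := by rw [hsurj.range_eq]; exact isClosed_univ
  have hZφ : (vanishingIdeal c₀).comap φ = (AffineCoordBlowup.𝓘Λ 4 K Λ).comap (𝟙 (P 4 K)) := by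
    rw [Scheme.IdealSheafData.comap_id]; exact hZ₀
  -- blow up the host
  set Ce : (P 4 K).IdealSheafData := vanishingIdeal c₀ with hCe
  have hπ : IsBlowup (blowup.π Ce) Ce := blowup.isBlowup Ce
  have hCsupp : ∀ z : P 4 K, z ∉ (Ce.support : Set (P 4 K)) ↔ z ∉ (c₀ : Set (P 4 K)) := fun z => by
    rw [hCe, Scheme.IdealSheafData.coe_support_vanishingIdeal]
  have hc₀supp : (c₀ : Set (P 4 K)) ⊆ M₀.support :=
    coe_member_subset_support φ (𝟙 _) M₀ rfl _ hM hS₀.2 c₀ hZφ (by rw [hsurj.range_eq]; exact Set.subset_univ _)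
  have h₁ : IsMultipleBlowup M₀ (blowup.π Ce ≫ 𝟙 _) (M₀.transform (blowup.π Ce) Ce) :=
    IsMultipleBlowup.blowup (IsMultipleBlowup.refl M₀) Ce (blowup.π Ce) hπ hreg₀
      (by rw [hCe, Scheme.IdealSheafData.coe_support_vanishingIdeal]; exact hc₀supp) hsnc₀
  haveI : IsLocallyNoetherian (blowup Ce) := h₁.isLocallyNoetherian
  set M₁ := M₀.transform (blowup.π Ce) Ce with hM₁
  have hM₁I : M₁.ideal = controlledTransform (blowup.π Ce) Ce M₀.ideal M₀.mult := rfl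
  -- the model and the comparison
  set B := blowup.π (AffineCoordBlowup.𝓘Λ 4 K Λ) with hBdef
  have hB : IsBlowup B (AffineCoordBlowup.𝓘Λ 4 K Λ) := blowup.isBlowup _
  obtain ⟨ε, hsq, hC', hKEY⟩ := ChartDictionary.exists_iso_restrict_blowup_zigzag φ (𝟙 _) _ Ce hZφ hπ hB
  have hK := hKEY M₀.ideal (hypSheaf p s₀.F) p hM
  -- the waiting entries are admissible for their kid states (part 31)
  have hW1' : ∀ wt ∈ Wt, wt.1 ∈ S₀ ∧ (∀ i ∈ S₀, wt.2.1 i = 0) ∧ S₀.erase wt.1 ⊆ wt.2.2 ∧ wt.1 ∉ wt.2.2 ∧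
      IsPermissibleCentre p wt.2.2 (CentreBlowup.step p S₀ wt.1 wt.2.1 s₀).F := fun wt hwt =>
    ⟨(hW1 wt hwt).1, (hW1 wt hwt).2.1, (hW1 wt hwt).2.2.1, (hW1 wt hwt).2.2.2.1,
      isPermissibleCentre_step_of_not_mem (hW1 wt hwt).1 (hW1 wt hwt).2.2.2.1 (hW1 wt hwt).2.1 s₀ (hW1 wt hwt).2.2.2.2⟩
  -- the step: children, waiting kids, leaves over the host
  obtain ⟨kid, wkid, hkid, hwkid, hkdisj, hkw, hww, hkcover, hwcover, hkfin⟩ :=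
    joint_forest_step_waiting_cover φ (𝟙 _) ε Ce hπ hB hsq hC' M₀ rfl rfl s₀ hK hS₀ hsee₀ hT₀ hψ hφc hsnc₀ Pl hP1₀ hP2₀
      Wt hW1' hW2 hPW L hcover₀
  have hkid_over : ∀ e ∈ Pl, ∀ w ∈ (kid e : Set (blowup Ce)), blowup.π Ce w ∈ (c₀ : Set (P 4 K)) :=
    fun e he w hw => by
    have h := (hkid e he).2.2.2.1 hw
    rwa [Set.mem_preimage, himg] at h
  have hkid_inj : ∀ e ∈ Pl, ∀ e' ∈ Pl, kid e = kid e' → e = e' := fun e he e' he' hee => by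
    by_contra hne
    obtain ⟨w, hw⟩ := (hkid e he).2.2.2.2
    exact Set.disjoint_left.mp (hkdisj e he e' he' hne) hw (by rw [← hee]; exact hw)
  have hwkid_inj : ∀ wt ∈ Wt, ∀ wt' ∈ Wt, wkid wt = wkid wt' → wt = wt' := fun wt hwt wt' hwt' hee => by
    by_contra hne
    obtain ⟨w, hw⟩ := (hwkid wt hwt).2.2.2.2
    exact Set.disjoint_left.mp (hww wt hwt wt' hwt' hne) hw (by rw [← hee]; exact hw)
  have hkid_ne_wkid : ∀ e ∈ Pl, ∀ wt ∈ Wt, kid e ≠ wkid wt := fun e he wt hwt hee => by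
    obtain ⟨w, hw⟩ := (hkid e he).2.2.2.2
    exact Set.disjoint_left.mp (hkw e he wt hwt) hw (by rw [← hee]; exact hw)
  -- leaf points: closed order-`p` points over the host outside all children and waiting kids
  have hkfin' : {w : blowup Ce | IsClosed ({w} : Set (blowup Ce)) ∧ blowup.π Ce w ∈ (c₀ : Set (P 4 K)) ∧
      (p : ℕ∞) ≤ idealOrder M₁.ideal w ∧ (∀ e ∈ Pl, w ∉ (kid e : Set (blowup Ce))) ∧
      ∀ wt ∈ Wt, w ∉ (wkid wt : Set (blowup Ce))}.Finite := by
    rw [himg] at hkfin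
    exact hkfin
  set ov : Finset (blowup Ce) := hkfin'.toFinset with hov_def
  have hmem_over : ∀ w, w ∈ ov ↔ IsClosed ({w} : Set (blowup Ce)) ∧ blowup.π Ce w ∈ (c₀ : Set (P 4 K)) ∧
      (p : ℕ∞) ≤ idealOrder M₁.ideal w ∧ (∀ e ∈ Pl, w ∉ (kid e : Set (blowup Ce))) ∧
      ∀ wt ∈ Wt, w ∉ (wkid wt : Set (blowup Ce)) := fun w => by
    rw [hov_def, Set.Finite.mem_toFinset, Set.mem_setOf_eq]
  have hleaf : ∀ w : blowup Ce, IsClosed ({w} : Set (blowup Ce)) → blowup.π Ce w ∈ (c₀ : Set (P 4 K)) →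
      (p : ℕ∞) ≤ idealOrder M₁.ideal w → (∀ e ∈ Pl, w ∉ (kid e : Set (blowup Ce))) →
      (∀ wt ∈ Wt, w ∉ (wkid wt : Set (blowup Ce))) →
      ∃ l ∈ L, l.1 ∈ S₀ ∧ l.2 l.1 = 0 ∧ CentreBlowup.IsEquimultiplePoint p S₀ l.1 l.2 s₀ ∧
        ∃ (Y' : Scheme.{0}) (φ' : Y' ⟶ blowup Ce) (ψ' : Y' ⟶ P 4 K) (_ : IsOpenImmersion φ') (_ : IsOpenImmersion ψ')
          (y' : Y'), φ' y' = w ∧ ψ' y' = ξ 4 K ∧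
          M₁.ideal.comap φ' = (hypSheaf p (CentreBlowup.step p S₀ l.1 l.2 s₀).F).comap ψ' := by
    intro w hw hwc hord hout houtw
    rw [← himg] at hwc
    rcases hkcover w hw hwc hord with ⟨e, he, hwe⟩ | ⟨wt, hwt, hwe⟩ | h
    · exact absurd hwe (hout e he)
    · exact absurd hwe (houtw wt hwt)
    · exact h
  set st' : blowup Ce → State K := fun w =>
    if hc : IsClosed ({w} : Set (blowup Ce)) ∧ blowup.π Ce w ∈ (c₀ : Set (P 4 K)) ∧
        (p : ℕ∞) ≤ idealOrder M₁.ideal w ∧ (∀ e ∈ Pl, w ∉ (kid e : Set (blowup Ce))) ∧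
        ∀ wt ∈ Wt, w ∉ (wkid wt : Set (blowup Ce)) then
      CentreBlowup.step p S₀ (hleaf w hc.1 hc.2.1 hc.2.2.1 hc.2.2.2.1 hc.2.2.2.2).choose.1
        (hleaf w hc.1 hc.2.1 hc.2.2.1 hc.2.2.2.1 hc.2.2.2.2).choose.2 s₀
    else s₀ with hst'
  -- the coordinate members of the new stage: children and waiting kids
  set kidsF : Finset (Closeds (blowup Ce)) := Pl.image kid with hkidsF
  set wkidsF : Finset (Closeds (blowup Ce)) := Wt.image wkid with hwkidsF
  have hdisj_kw : Disjoint kidsF wkidsF := Finset.disjoint_left.mpr fun ⦃d⦄ hd hd' => by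
    obtain ⟨e, he, rfl⟩ := Finset.mem_image.mp hd
    obtain ⟨wt, hwt, hce⟩ := Finset.mem_image.mp hd'
    exact hkid_ne_wkid e he wt hwt hce.symm
  set cms' : Finset (Closeds (blowup Ce)) := kidsF.disjUnion wkidsF hdisj_kw with hcms'
  have hmem_cms' : ∀ d, d ∈ cms' ↔ (∃ e ∈ Pl, kid e = d) ∨ ∃ wt ∈ Wt, wkid wt = d := fun d => by
    rw [hcms', Finset.mem_disjUnion, hkidsF, hwkidsF, Finset.mem_image, Finset.mem_image]
  set cst' : Closeds (blowup Ce) → State K := fun d =>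
    if h : ∃ e ∈ Pl, kid e = d then CentreBlowup.step p S₀ h.choose.1 h.choose.2.1 s₀
    else if h' : ∃ wt ∈ Wt, wkid wt = d then CentreBlowup.step p S₀ h'.choose.1 h'.choose.2.1 s₀ else s₀ with hcst'
  set ctr' : Closeds (blowup Ce) → Finset (Fin 4) := fun d =>
    if h : ∃ e ∈ Pl, kid e = d then h.choose.2.2
    else if h' : ∃ wt ∈ Wt, wkid wt = d then h'.choose.2.2 else S₀ with hctr'
  have hkid_rep : ∀ e ∈ Pl, cst' (kid e) = CentreBlowup.step p S₀ e.1 e.2.1 s₀ ∧ ctr' (kid e) = e.2.2 := by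
    intro e he
    have h : ∃ e' ∈ Pl, kid e' = kid e := ⟨e, he, rfl⟩
    have hch : h.choose = e := hkid_inj _ h.choose_spec.1 e he h.choose_spec.2
    exact ⟨by simp only [hcst', dif_pos h]; rw [hch], by simp only [hctr', dif_pos h]; rw [hch]⟩
  have hwkid_rep : ∀ wt ∈ Wt, cst' (wkid wt) = CentreBlowup.step p S₀ wt.1 wt.2.1 s₀ ∧ ctr' (wkid wt) = wt.2.2 := by
    intro wt hwt
    have hn : ¬ ∃ e ∈ Pl, kid e = wkid wt := fun ⟨e, he, hec⟩ => hkid_ne_wkid e he wt hwt hec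
    have h' : ∃ wt' ∈ Wt, wkid wt' = wkid wt := ⟨wt, hwt, rfl⟩
    have hch : h'.choose = wt := hwkid_inj _ h'.choose_spec.1 wt hwt h'.choose_spec.2
    exact ⟨by simp only [hcst', dif_neg hn, dif_pos h']; rw [hch], by simp only [hctr', dif_neg hn, dif_pos h']; rw [hch]⟩
  -- the multiset of the new members is accessible
  haveI : Std.Irrefl (fun q' q : State K × Finset (Fin 4) =>
      (∃ e ∈ plan q.1 q.2, q' = (CentreBlowup.step p q.2 e.1 e.2.1 q.1, e.2.2)) ∧ q' ≠ q) := ⟨fun q hq => hq.2 rfl⟩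
  have hT : Acc (Relation.CutExpand (fun q' q : State K × Finset (Fin 4) =>
      (∃ e ∈ plan q.1 q.2, q' = (CentreBlowup.step p q.2 e.1 e.2.1 q.1, e.2.2)) ∧ q' ≠ q))
      (cms'.val.map fun d => (cst' d, ctr' d)) := by
    refine Relation.acc_of_singleton fun q hq => ?_
    rw [Multiset.mem_map] at hq
    obtain ⟨d, hd, rfl⟩ := hq
    rcases (hmem_cms' d).mp (Finset.mem_val.mp hd) with ⟨e, he, rfl⟩ | ⟨wt, hwt, rfl⟩
    · obtain ⟨h1, h2⟩ := hkid_rep e he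
      rw [h1, h2]
      exact (Subrelation.accessible (fun hs => hs.1) (hacc e he)).cutExpand
    · obtain ⟨h1, h2⟩ := hwkid_rep wt hwt
      rw [h1, h2]
      exact (Subrelation.accessible (fun hs => hs.1) (hWacc wt hwt)).cutExpand
  -- hand over to the node theorem at the first blown-up stage
  refine exists_isMarkedResolution_of_joint_forest_normalised M₀ hE₀ rfl plan leaves _ hT (blowup Ce)
    (blowup.π Ce ≫ 𝟙 _) M₁ h₁ ov st' (fun w hw => ((hmem_over w).mp hw).1) (fun w hw => ?_) cms' cst' ctr' rfl
    (fun d hd => ?_) (fun d hd d' hd' hdd => ?_) (fun w hw d hd => ?_) (fun z hz hzo => ?_)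
  · -- data of the point members (leaves)
    have hc := (hmem_over w).mp hw
    obtain ⟨hl, hl1, hl2, heq, Y', φ', ψ', _, _, y', hφ', hψ', hMw⟩ :=
      (hleaf w hc.1 hc.2.1 hc.2.2.1 hc.2.2.2.1 hc.2.2.2.2).choose_spec
    have hst'w : st' w = CentreBlowup.step p S₀ (hleaf w hc.1 hc.2.1 hc.2.2.1 hc.2.2.2.1 hc.2.2.2.2).choose.1
        (hleaf w hc.1 hc.2.1 hc.2.2.1 hc.2.2.2.1 hc.2.2.2.2).choose.2 s₀ := by rw [hst']; exact dif_pos hc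
    obtain ⟨haccl, hfinl⟩ := hP3₀ _ hl heq
    rw [hst'w]
    refine ⟨step_F_ne_zero_of_isClean hl1 _ s₀ hF₀ hclean₀ hS₀.2, isClean_step S₀ _ _ s₀,
      ordAlong_univ_step_of_isEquimultiplePoint' S₀ _ _ s₀ heq, haccl, fun s' hs' => ?_, Y', φ', ψ',
      inferInstance, inferInstance, y', hφ', hψ', hMw⟩
    exact finite_closedOver_model_of_finite_pairs s'
      (ordAlong_univ_of_reflTransGen_edge (ordAlong_univ_step_of_isEquimultiplePoint' S₀ _ _ s₀ heq) hs') (hfinl s' hs')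
  · -- data of the coordinate members: children and waiting kids
    rcases (hmem_cms' d).mp hd with ⟨e, he, rfl⟩ | ⟨wt, hwt, rfl⟩
    · obtain ⟨hcst, hctr⟩ := hkid_rep e he
      rw [hcst, hctr]
      obtain ⟨hreg, hsnc, hzig, -, -⟩ := hkid e he
      obtain ⟨hj, hbj, hsub, heq, hperm''⟩ := hP1₀ e he
      refine ⟨step_F_ne_zero_of_isClean hj e.2.1 s₀ hF₀ hclean₀ hS₀.2, isClean_step S₀ e.1 e.2.1 s₀, hperm'', hreg,
        hsnc, hzig, fun q hq => hplan q (Or.inl ⟨e, he, hq⟩), hacc e he⟩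
    · obtain ⟨hcst, hctr⟩ := hwkid_rep wt hwt
      rw [hcst, hctr]
      obtain ⟨hreg, hsnc, hzig, -, -⟩ := hwkid wt hwt
      obtain ⟨hj, -, -, -, hperm''⟩ := hW1' wt hwt
      exact ⟨step_F_ne_zero_of_isClean hj wt.2.1 s₀ hF₀ hclean₀ hS₀.2, isClean_step S₀ wt.1 wt.2.1 s₀, hperm'', hreg,
        hsnc, hzig, fun q hq => hplan q (Or.inr ⟨wt, hwt, hq⟩), hWacc wt hwt⟩
  · -- the coordinate members are pairwise disjoint
    rcases (hmem_cms' d).mp hd with ⟨e, he, rfl⟩ | ⟨wt, hwt, rfl⟩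
    · rcases (hmem_cms' d').mp hd' with ⟨e', he', rfl⟩ | ⟨wt', hwt', rfl⟩
      · exact hkdisj e he e' he' fun h => hdd (by rw [h])
      · exact hkw e he wt' hwt'
    · rcases (hmem_cms' d').mp hd' with ⟨e', he', rfl⟩ | ⟨wt', hwt', rfl⟩
      · exact (hkw e' he' wt hwt).symm
      · exact hww wt hwt wt' hwt' fun h => hdd (by rw [h])
  · -- point members avoid coordinate members
    rcases (hmem_cms' d).mp hd with ⟨e, he, rfl⟩ | ⟨wt, hwt, rfl⟩
    · exact ((hmem_over w).mp hw).2.2.2.1 e he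
    · exact ((hmem_over w).mp hw).2.2.2.2 wt hwt
  · -- every closed order-`p` point of the new stage is a member
    by_cases hk : ∃ e ∈ Pl, z ∈ (kid e : Set (blowup Ce))
    · obtain ⟨e, he, hze⟩ := hk
      exact Or.inr ⟨kid e, (hmem_cms' _).mpr (Or.inl ⟨e, he, rfl⟩), hze⟩
    by_cases hkw' : ∃ wt ∈ Wt, z ∈ (wkid wt : Set (blowup Ce))
    · obtain ⟨wt, hwt, hze⟩ := hkw'
      exact Or.inr ⟨wkid wt, (hmem_cms' _).mpr (Or.inr ⟨wt, hwt, rfl⟩), hze⟩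
    push Not at hk hkw'
    by_cases hzx : blowup.π Ce z ∈ (c₀ : Set (P 4 K))
    · exact Or.inl ((hmem_over z).mpr ⟨hz, hzx, hzo, hk, hkw'⟩)
    · -- off the host: over a waiting member, hence on a waiting kid (part 36) — contradiction
      exfalso
      have hnot : blowup.π Ce z ∉ (Ce.support : Set (P 4 K)) := (hCsupp _).mpr hzx
      have hzo' : (p : ℕ∞) ≤ idealOrder (hypSheaf p F) (blowup.π Ce z) := by
        rw [← idealOrder_controlledTransform_eq_of_eq_of_not_mem_support hπ hnot M₀.ideal p rfl]
        exact hzo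
      have hzc : IsClosed ({blowup.π Ce z} : Set (P 4 K)) := isClosed_singleton_π' hπ hz
      obtain ⟨a', b', hzab⟩ := exists_eq_vanishingIdeal_cons_of_isClosed hzc
      have hord' := (natCast_le_idealOrder_hypSheaf_iff (p := p) F hzab p).mp hzo'
      rw [natCast_le_ordZero_translate_hyp_iff] at hord'
      obtain ⟨-, H⟩ := hord'
      rcases hroots b' H with hhost | ⟨wt, hwt, hagree⟩
      · exact hzx (hon₀ _ hzc (le_trans (by exact_mod_cast hp.out.one_lt.le) hzo')
          fun i hi => (X_succ_sub_C_mem_asIdeal_iff i _ a' b' hzab).mpr (hhost i hi))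
      · refine hkw' wt hwt (hwcover z hz hzo (by rw [himg]; exact hzx) wt hwt ?_)
        obtain ⟨y, hy⟩ := hsurj (blowup.π Ce z)
        refine ⟨y, ?_, hy⟩
        rw [hid, Set.mem_setOf_eq]
        intro i hi
        rw [← hcoord' y i (wt.2.1 i), hy]
        exact (X_succ_sub_C_mem_asIdeal_iff i _ a' b' hzab).mpr (hagree i hi)

end RootWaiting

end Equimultiple

end Summit.ResolutionOfSingularities.ResolutionOfSingularities.Theorems.PIDim4

end
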